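import Summits.CriticalPhenomena.PercolationContinuityZ3.Theorems.PercNearOneGluingNoHeavyLowerTailSahiGridPatternPairCert

/-!
# `NoHeavyLowerTail` (crux stmt-CriticalPhenomena-4575), Sahi programme P1: THE NONNEGATIVE FAMILIES OF THE TWO-ORTHANT IDENTITY
# (Harris, fibre-Kleitman and Conjecture-P forms as weighted pair sums)

Support file (Sahi cell, seat `prim-sahi-p1`, generation 21; `--supports stmt-CriticalPhenomena-4575`).  Pure proofs, no definitions,
no `sorry`, standard axioms.  Each lemma restates a tree inequality — coefficientwise Harris (`sum_ind_totDist_le`), fibre Kleitman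
(`sum_ind_lat_le_td`), the Harris-sharpened orthant theorem = Conjecture P (`sStarD_principal_ge_harris`) — as the nonnegativity of a sum
`Σ_{q,r} [q δ̸ r]·(kernel)` over ordered totally-distinct pairs, in exactly the kernel shapes that occur in the two-orthant identity
(`…SahiGridPatternTwoOrthant`): `P(q)(Q(q) − Q(r))` (Harris), `V(q)P(r)(Q(r) − Q(q̄r))` (Kleitman), `P(q)Q(q)Y(q) − P(q)Q(r)(Y(q)+Y(r)−Y(q̄r))`
(Conjecture P, Θ-form) and `X(ξ)(β(ξ) − β(η))(γ(ξ) − γ(ξ̄η))` (Conjecture P, witness form). [this work]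
-/

namespace Summit.CriticalPhenomena.PercolationContinuityZ3.Theorems.SahiGridPattern

open Finset SahiGrid3
open scoped BigOperators

variable {d : ℕ}

/-- Indicator of a complement: `1_{univ ∖ S} = 1 − 1_S`. [this work] -/
theorem ind_sdiff_univ (S : Finset (Pd d)) (q : Pd d) : ind (univ \ S) q = 1 - ind S q := by
  unfold ind
  by_cases h : q ∈ S
  · simp [h]
  · simp [h]

/-- **Harris in kernel form**: `0 ≤ Σ_{q,r}[q δ̸ r]·P(q)(Q(q) − Q(r))` for up-sets `P, Q`. [this work] -/
theorem pairKernel_harris_nonneg (P Q : Finset (Pd d)) (hP : IsUpperSet (P : Set (Pd d))) (hQ : IsUpperSet (Q : Set (Pd d))) :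
    0 ≤ ∑ q : Pd d, ∑ r : Pd d, (if TotDist q r = true then (1:ℤ) else 0) * (ind P q * (ind Q q - ind Q r)) := by
  have h := sum_ind_totDist_le d P Q hP hQ
  have e : (∑ q : Pd d, ∑ r : Pd d, (if TotDist q r = true then (1:ℤ) else 0) * (ind P q * (ind Q q - ind Q r))) =
      2 ^ d * (∑ q, ind P q * ind Q q) - ∑ q, ∑ r, ind P q * ind Q r * (if TotDist q r = true then (1:ℤ) else 0) := by
    rw [Finset.mul_sum, ← Finset.sum_sub_distrib]
    refine Finset.sum_congr rfl fun q _ => ?_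
    rw [← sum_ite_totDist_eq_two_pow q, Finset.sum_mul, ← Finset.sum_sub_distrib]
    refine Finset.sum_congr rfl fun r _ => ?_
    ring
  rw [e]; linarith

/-- **Fibre Kleitman in kernel form**: `0 ≤ Σ_{q,r}[q δ̸ r]·V(q)P(r)(Q(r) − Q(q̄r))` for up-sets `P, Q` and any `V`. [this work] -/
theorem pairKernel_kleitman_nonneg (V P Q : Finset (Pd d)) (hP : IsUpperSet (P : Set (Pd d))) (hQ : IsUpperSet (Q : Set (Pd d))) :
    0 ≤ ∑ q : Pd d, ∑ r : Pd d, (if TotDist q r = true then (1:ℤ) else 0) * (ind V q * ind P r * (ind Q r - ind Q (thirdPt q r))) := by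
  have h := sum_ind_lat_le_td V hP hQ
  have e : (∑ q : Pd d, ∑ r : Pd d, (if TotDist q r = true then (1:ℤ) else 0) * (ind V q * ind P r * (ind Q r - ind Q (thirdPt q r)))) =
      (∑ q, ∑ r, ind V q * ind P r * ind Q r * (if TotDist q r = true then (1:ℤ) else 0))
        - ∑ q, ∑ r, ind V q * ind P r * ind Q (thirdPt q r) * (if TotDist q r = true then (1:ℤ) else 0) := by
    simp only [← Finset.sum_sub_distrib]
    refine Finset.sum_congr rfl fun q _ => Finset.sum_congr rfl fun r _ => ?_
    ring
  rw [e]; linarith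

/-- The Harris-reduced functional of a principal up-set is nonnegative, COUNTING FORM:
`0 ≤ 2^d·#(XPQ) − Σ[δ̸]P(p)X(q)Q(q) − Σ[δ̸]Q(p)X(q)P(q) + Σ[δ̸]P(q)Q(r)X(q̄r)` (`= sStarD X P Q − H(X,P∩Q)`, Conjecture P). [this work] -/
theorem harrisReduced_principal_counting_nonneg (a : Pd d) (P Q : Finset (Pd d))
    (hP : IsUpperSet (P : Set (Pd d))) (hQ : IsUpperSet (Q : Set (Pd d))) :
    0 ≤ 2 ^ d * (∑ p, ind (univ.filter fun x : Pd d => ∀ i, a i ≤ x i) p * ind P p * ind Q p)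
      - (∑ p, ∑ q, ind P p * ind (univ.filter fun x : Pd d => ∀ i, a i ≤ x i) q * ind Q q * (if TotDist p q = true then (1:ℤ) else 0))
      - (∑ p, ∑ q, ind Q p * ind (univ.filter fun x : Pd d => ∀ i, a i ≤ x i) q * ind P q * (if TotDist p q = true then (1:ℤ) else 0))
      + (∑ q, ∑ r, ind P q * ind Q r * ind (univ.filter fun x : Pd d => ∀ i, a i ≤ x i) (thirdPt q r) * (if TotDist q r = true then (1:ℤ) else 0)) := by
  have hc := sStarD_counting (univ.filter fun x : Pd d => ∀ i, a i ≤ x i) P Q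
  have hp := sStarD_principal_ge_harris d a P Q hP hQ
  have hpow : (2:ℤ) * 2 ^ d = 2 ^ d + 2 ^ d := by ring
  nlinarith [hc, hp, hpow]

/-- **Conjecture P in kernel form (Θ-form)**: for `Y = ↑b` principal and up-sets `P, Q`,
`0 ≤ Σ_{q,r}[q δ̸ r]·(P(q)Q(q)Y(q) − P(q)Q(r)(Y(q) + Y(r) − Y(q̄r)))`  (`= G(Y;P,Q) = sStarD Y P Q − H(Y,P∩Q)`). [this work] -/
theorem pairKernel_conjP_theta_nonneg (b : Pd d) (P Q : Finset (Pd d)) (hP : IsUpperSet (P : Set (Pd d))) (hQ : IsUpperSet (Q : Set (Pd d))) :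
    0 ≤ ∑ q : Pd d, ∑ r : Pd d, (if TotDist q r = true then (1:ℤ) else 0) *
      (ind P q * ind Q q * ind (univ.filter fun x : Pd d => ∀ i, b i ≤ x i) q
        - ind P q * ind Q r * (ind (univ.filter fun x : Pd d => ∀ i, b i ≤ x i) q + ind (univ.filter fun x : Pd d => ∀ i, b i ≤ x i) r
            - ind (univ.filter fun x : Pd d => ∀ i, b i ≤ x i) (thirdPt q r))) := by
  set Yb : Finset (Pd d) := univ.filter fun x : Pd d => ∀ i, b i ≤ x i with hYb
  have h := harrisReduced_principal_counting_nonneg b P Q hP hQ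
  rw [← hYb] at h
  -- express the kernel sum through the four counting atoms
  have e1 : (∑ q : Pd d, ∑ r : Pd d, (if TotDist q r = true then (1:ℤ) else 0) * (ind P q * ind Q q * ind Yb q)) =
      2 ^ d * (∑ p, ind Yb p * ind P p * ind Q p) := by
    rw [Finset.mul_sum]
    refine Finset.sum_congr rfl fun q _ => ?_
    rw [← sum_ite_totDist_eq_two_pow q, Finset.sum_mul]
    refine Finset.sum_congr rfl fun r _ => ?_
    ring
  have e2 : (∑ q : Pd d, ∑ r : Pd d, (if TotDist q r = true then (1:ℤ) else 0) * (ind P q * ind Q r * ind Yb q)) =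
      ∑ p, ∑ q, ind Q p * ind Yb q * ind P q * (if TotDist p q = true then (1:ℤ) else 0) := by
    rw [Finset.sum_comm]
    refine Finset.sum_congr rfl fun r _ => Finset.sum_congr rfl fun q _ => ?_
    rw [totDist_symm]; ring
  have e3 : (∑ q : Pd d, ∑ r : Pd d, (if TotDist q r = true then (1:ℤ) else 0) * (ind P q * ind Q r * ind Yb r)) =
      ∑ p, ∑ q, ind P p * ind Yb q * ind Q q * (if TotDist p q = true then (1:ℤ) else 0) := by
    refine Finset.sum_congr rfl fun q _ => Finset.sum_congr rfl fun r _ => ?_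
    ring
  have e4 : (∑ q : Pd d, ∑ r : Pd d, (if TotDist q r = true then (1:ℤ) else 0) * (ind P q * ind Q r * ind Yb (thirdPt q r))) =
      ∑ q, ∑ r, ind P q * ind Q r * ind Yb (thirdPt q r) * (if TotDist q r = true then (1:ℤ) else 0) := by
    refine Finset.sum_congr rfl fun q _ => Finset.sum_congr rfl fun r _ => ?_
    ring
  have e : (∑ q : Pd d, ∑ r : Pd d, (if TotDist q r = true then (1:ℤ) else 0) *
      (ind P q * ind Q q * ind Yb q - ind P q * ind Q r * (ind Yb q + ind Yb r - ind Yb (thirdPt q r)))) =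
      (∑ q : Pd d, ∑ r : Pd d, (if TotDist q r = true then (1:ℤ) else 0) * (ind P q * ind Q q * ind Yb q))
      - (∑ q : Pd d, ∑ r : Pd d, (if TotDist q r = true then (1:ℤ) else 0) * (ind P q * ind Q r * ind Yb q))
      - (∑ q : Pd d, ∑ r : Pd d, (if TotDist q r = true then (1:ℤ) else 0) * (ind P q * ind Q r * ind Yb r))
      + (∑ q : Pd d, ∑ r : Pd d, (if TotDist q r = true then (1:ℤ) else 0) * (ind P q * ind Q r * ind Yb (thirdPt q r))) := by
    simp only [← Finset.sum_sub_distrib, ← Finset.sum_add_distrib]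
    refine Finset.sum_congr rfl fun q _ => Finset.sum_congr rfl fun r _ => ?_
    ring
  rw [e, e1, e2, e3, e4]
  linarith

/-- Rotation reindexing for a plain double sum: `Σ_{ξ,η}[ξ δ̸ η]·G(ξ, η, ξ̄η) = Σ_{ξ,η}[ξ δ̸ η]·G(ξ, ξ̄η, η)`. [this work] -/
theorem pairSum_rot (G : Pd d → Pd d → Pd d → ℤ) :
    (∑ ξ : Pd d, ∑ η : Pd d, (if TotDist ξ η = true then (1:ℤ) else 0) * G ξ η (thirdPt ξ η)) =
      ∑ ξ : Pd d, ∑ η : Pd d, (if TotDist ξ η = true then (1:ℤ) else 0) * G ξ (thirdPt ξ η) η := by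
  refine Finset.sum_congr rfl fun ξ _ => ?_
  rw [← Equiv.sum_comp (Function.Involutive.toPerm (thirdPt ξ) (fun η => thirdPt_thirdPt ξ η))
    (fun η => (if TotDist ξ η = true then (1:ℤ) else 0) * G ξ η (thirdPt ξ η))]
  refine Finset.sum_congr rfl fun η _ => ?_
  show (if TotDist ξ (thirdPt ξ η) = true then (1:ℤ) else 0) * G ξ (thirdPt ξ η) (thirdPt ξ (thirdPt ξ η)) = _
  rw [thirdPt_thirdPt, show TotDist ξ (thirdPt ξ η) = TotDist ξ η from by rw [Bool.eq_iff_iff, totDist_thirdPt_iff]]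

/-- Transposition reindexing for a plain double sum: `Σ_{ξ,η}[ξ δ̸ η]·G(ξ,η,ξ̄η) = Σ_{ξ,η}[ξ δ̸ η]·G(η,ξ,ξ̄η)`. [this work] -/
theorem pairSum_swap (G : Pd d → Pd d → Pd d → ℤ) :
    (∑ ξ : Pd d, ∑ η : Pd d, (if TotDist ξ η = true then (1:ℤ) else 0) * G ξ η (thirdPt ξ η)) =
      ∑ ξ : Pd d, ∑ η : Pd d, (if TotDist ξ η = true then (1:ℤ) else 0) * G η ξ (thirdPt ξ η) := by
  rw [Finset.sum_comm]
  refine Finset.sum_congr rfl fun ξ _ => Finset.sum_congr rfl fun η _ => ?_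
  rw [totDist_symm η ξ, thirdPt_comm η ξ]

/-- **Conjecture P in kernel form (witness form)**: for `X = ↑a` principal and up-sets `β, γ`,
`0 ≤ Σ_{ξ,η}[ξ δ̸ η]·X(ξ)(β(ξ) − β(η))(γ(ξ) − γ(ξ̄η))` (`= G(X;β,γ)`). [this work] -/
theorem pairKernel_conjP_witness_nonneg (a : Pd d) (β γ : Finset (Pd d)) (hβ : IsUpperSet (β : Set (Pd d))) (hγ : IsUpperSet (γ : Set (Pd d))) :
    0 ≤ ∑ ξ : Pd d, ∑ η : Pd d, (if TotDist ξ η = true then (1:ℤ) else 0) *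
      (ind (univ.filter fun x : Pd d => ∀ i, a i ≤ x i) ξ * (ind β ξ - ind β η) * (ind γ ξ - ind γ (thirdPt ξ η))) := by
  set Xa : Finset (Pd d) := univ.filter fun x : Pd d => ∀ i, a i ≤ x i with hXa
  have h := harrisReduced_principal_counting_nonneg a β γ hβ hγ
  rw [← hXa] at h
  have e1 : (∑ ξ : Pd d, ∑ η : Pd d, (if TotDist ξ η = true then (1:ℤ) else 0) * (ind Xa ξ * ind β ξ * ind γ ξ)) =
      2 ^ d * (∑ p, ind Xa p * ind β p * ind γ p) := by
    rw [Finset.mul_sum]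
    refine Finset.sum_congr rfl fun q _ => ?_
    rw [← sum_ite_totDist_eq_two_pow q, Finset.sum_mul]
  -- `Σ[δ̸] X(ξ)β(ξ)γ(ξ̄η) = Σ[δ̸] γ(p)X(q)β(q)`
  have e2 : (∑ ξ : Pd d, ∑ η : Pd d, (if TotDist ξ η = true then (1:ℤ) else 0) * (ind Xa ξ * ind β ξ * ind γ (thirdPt ξ η))) =
      ∑ p, ∑ q, ind γ p * ind Xa q * ind β q * (if TotDist p q = true then (1:ℤ) else 0) := by
    rw [pairSum_rot (fun ξ η ζ => ind Xa ξ * ind β ξ * ind γ ζ), pairSum_swap (fun ξ η ζ => ind Xa ξ * ind β ξ * ind γ η)]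
    refine Finset.sum_congr rfl fun p _ => Finset.sum_congr rfl fun q _ => ?_
    ring
  -- `Σ[δ̸] X(ξ)γ(ξ)β(η) = Σ[δ̸] β(p)X(q)γ(q)`
  have e3 : (∑ ξ : Pd d, ∑ η : Pd d, (if TotDist ξ η = true then (1:ℤ) else 0) * (ind Xa ξ * ind β η * ind γ ξ)) =
      ∑ p, ∑ q, ind β p * ind Xa q * ind γ q * (if TotDist p q = true then (1:ℤ) else 0) := by
    rw [pairSum_swap (fun ξ η ζ => ind Xa ξ * ind β η * ind γ ξ)]
    refine Finset.sum_congr rfl fun p _ => Finset.sum_congr rfl fun q _ => ?_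
    ring
  -- `Σ[δ̸] X(ξ)β(η)γ(ξ̄η) = Σ[δ̸] β(q)γ(r)X(q̄r)`
  have e4 : (∑ ξ : Pd d, ∑ η : Pd d, (if TotDist ξ η = true then (1:ℤ) else 0) * (ind Xa ξ * ind β η * ind γ (thirdPt ξ η))) =
      ∑ q, ∑ r, ind β q * ind γ r * ind Xa (thirdPt q r) * (if TotDist q r = true then (1:ℤ) else 0) := by
    rw [pairSum_rot (fun ξ η ζ => ind Xa ξ * ind β η * ind γ ζ), pairSum_swap (fun ξ η ζ => ind Xa ξ * ind β ζ * ind γ η),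
      pairSum_rot (fun ξ η ζ => ind Xa η * ind β ζ * ind γ ξ), pairSum_swap (fun ξ η ζ => ind Xa ζ * ind β η * ind γ ξ)]
    refine Finset.sum_congr rfl fun p _ => Finset.sum_congr rfl fun q _ => ?_
    ring
  have e : (∑ ξ : Pd d, ∑ η : Pd d, (if TotDist ξ η = true then (1:ℤ) else 0) *
      (ind Xa ξ * (ind β ξ - ind β η) * (ind γ ξ - ind γ (thirdPt ξ η)))) =
      (∑ ξ : Pd d, ∑ η : Pd d, (if TotDist ξ η = true then (1:ℤ) else 0) * (ind Xa ξ * ind β ξ * ind γ ξ))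
      - (∑ ξ : Pd d, ∑ η : Pd d, (if TotDist ξ η = true then (1:ℤ) else 0) * (ind Xa ξ * ind β ξ * ind γ (thirdPt ξ η)))
      - (∑ ξ : Pd d, ∑ η : Pd d, (if TotDist ξ η = true then (1:ℤ) else 0) * (ind Xa ξ * ind β η * ind γ ξ))
      + (∑ ξ : Pd d, ∑ η : Pd d, (if TotDist ξ η = true then (1:ℤ) else 0) * (ind Xa ξ * ind β η * ind γ (thirdPt ξ η))) := by
    simp only [← Finset.sum_sub_distrib, ← Finset.sum_add_distrib]
    refine Finset.sum_congr rfl fun q _ => Finset.sum_congr rfl fun r _ => ?_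
    ring
  rw [e, e1, e2, e3, e4]
  linarith

end Summit.CriticalPhenomena.PercolationContinuityZ3.Theorems.SahiGridPattern
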